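import Mathlib.MeasureTheory.Measure.Haar.Basic
import Mathlib.MeasureTheory.Group.Integral
import Mathlib.Analysis.Calculus.ParametricIntegral
import Literature.NumberTheory.Automorphic.AutomorphicFormsStable
import Literature.NumberTheory.Automorphic.ArchimedeanCalculusProofs
import Literature.NumberTheory.Automorphic.ArchimedeanApplyFreeCongr
import Literature.NumberTheory.Automorphic.RealMatrixGroupsExpOpen
import Literature.NumberTheory.Automorphic.ArchFlowParametricIntegral
import HarnessLib

/-!
# Borel–Jacquet 4.3 for a general regular datum, reduced to Harish-Chandra's convolution identity

Topic `NumberTheory/Automorphic`; sibling proof file of `AutomorphicForms` and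
`AutomorphicFormsStable`.
The named fact `automorphicForms_isStableSubmodule 𝒟` (Borel–Jacquet 1979, 4.3: for a regular
automorphy datum `𝒟` over a finite-dimensional coefficient algebra the space
`𝒜 = automorphicForms 𝒟` is `(𝔤, K_∞) × G(𝔸_f)`-stable) was reduced in `AutomorphicFormsStable`
(`automorphicForms_isStableSubmodule_of`) to three inputs: the calculus facts
`isArchSmooth_lieDeriv`, `applyFree_congr` — both now theorems for every linear real group
(`isArchSmooth_lieDeriv_holds`, `applyFree_congr_holds`) — and the moderate growth of the Lie
derivatives `X φ` of automorphic forms.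
In print the latter is Harish-Chandra's convolution identity `φ = φ ∗ α`, `α ∈ C_c^∞(G_∞)`
(Harish-Chandra 1966, §8 Thm. 1; Borel 1972, Thm. 3.18–3.19; Moeglin–Waldspurger 1995, I.2.17,
Lemma), followed by the elementary estimate `X(φ ∗ α) = φ ∗ Xα` (Borel 1997, Prop. 5.2, Cor. 5.3,
5.6 (c); Moeglin–Waldspurger 1995, Lemma I.2.5 (a)). This file PROVES the elementary half for an
arbitrary linear real group `H` with full Lie algebra and an arbitrary regular datum, so that the
fact rests on exactly ONE printed theorem, Harish-Chandra's, in the form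
`φ(h) = ∫_{G_∞} φ(h y) α(y⁻¹) dν(y)` (`ν` a left Haar measure; Borel's `φ ∗ α`):

* `IsArchSmooth.continuous_of_id` — functions on `H` smooth in the archimedean variable are
  continuous (von Neumann–Cartan charts, `RealMatrixGroup.continuous_of_continuousAt_comp_expMem`;
  through a private copy of `IsArchSmooth.continuous_comp_mul` of `AutomorphicFormsGKModuleProofs`);
* `lieDeriv_id_eq_zero_of_notMem_tsupport`, `hasCompactSupport_lieDeriv_id` — `Xα` is supported in
  `supp α`;
* `lieDeriv_eq_integral_of_convolution_eq` — **`X(φ ∗ α) = φ ∗ Xα`**: if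
  `φ(h) = ∫ φ(h ι(y)) α(y⁻¹) dν(y)` for all `h`, then `(X φ)(g) = ∫ φ(g ι(y)) (Xα)(y⁻¹) dν(y)` (left
  invariance of `ν`, the flow derivative `d/dt α(z exp tX) = (Xα)(z exp tX)` of
  `ArchFlowParametricIntegral`, differentiation under the integral sign);
* `hasModerateGrowth_lieDeriv_of_convolution_eq` — for a regular datum, `X φ` has moderate growth
  with the exponent of `φ` (`IsRegular.height_mul_ofArch_le` on the compact support);
* `automorphicForms_isStableSubmodule_of_convolution_identity` — **Borel–Jacquet 4.3 for the general
  regular datum from Harish-Chandra's identity alone**.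

Everything here is proved; no definitions, no named facts (the convolution identity enters as an
explicit hypothesis, stated exactly as the conclusion of Harish-Chandra's theorem).

## References

* A. Borel, H. Jacquet, *Automorphic forms and automorphic representations*, Proc. Sympos. Pure
  Math. 33 (Corvallis 1977), Part 1 (1979), 189–202, 4.3 [BorelJacquetCorvallis1979] (not held;
  cross-checked against the three sources below).
* Harish-Chandra, *Discrete series for semisimple Lie groups. II*, Acta Math. 116 (1966), §8 Thm. 1
  [HarishChandra1966]; A. Borel, *Représentations de groupes localement compacts*, LNM 276 (1972),
  Thm. 3.18, Cor. 3.19 (PDF pp. 25–26) [Borel1972].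
* A. Borel, *Automorphic forms on `SL₂(ℝ)`* (1997), Thm. 2.14 (p. 21), Prop. 5.2, Cor. 5.3, 5.6
  (pp. 49–50) [Borel1997].
* C. Moeglin, J.-L. Waldspurger, *Spectral decomposition and Eisenstein series* (1995), Lemma
  I.2.5 (a) (p. 77 of the held copy), I.2.17 and its Lemma (pp. 85–87) [MoeglinWaldspurger1995].
-/

noncomputable section

open MeasureTheory Filter Set Metric
open scoped MatrixGroups Matrix ContDiff Topology

namespace Literature.NumberTheory.Automorphic

/-! ### Archimedean-smooth functions along a linear real group with full Lie algebra -/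

section General

variable {A : Type*} [NormedCommRing A] [NormedAlgebra ℝ A] [NormedAlgebra ℚ A] [CompleteSpace A]
  [StarRing A] {N : Type*} [Fintype N] [DecidableEq N] {H : RealMatrixGroup A N}
  {G : Type*} [Group G] (ι : H.carrier →* G)

/-- `exp (0 · X) = 1` in `H`. [folklore] -/
private theorem expMem_zero_smul (X : H.lie) : H.expMem ((0 : ℝ) • X) = 1 := by
  refine Subtype.ext ?_
  change expGL (((0 : ℝ) • X : H.lie) : Matrix N N A) = 1
  have h0 : (((0 : ℝ) • X : H.lie) : Matrix N N A) = 0 := by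
    change (0 : ℝ) • (X : Matrix N N A) = 0
    exact zero_smul _ _
  rw [h0, expGL_zero]

set_option backward.isDefEq.respectTransparency false in
open scoped Matrix.Norms.Operator in
/-- Functions smooth in the archimedean variable are continuous along `H` (linear real group with
full Lie algebra, finite-dimensional coefficients): `y ↦ φ (g ι(y))` is continuous, its exponential
slices being smooth and the charts `X ↦ y₀ exp X` open at `0` (von Neumann–Cartan,
`RealMatrixGroup.continuous_of_continuousAt_comp_expMem`). Private copy of
`IsArchSmooth.continuous_comp_mul` of `AutomorphicFormsGKModuleProofs`, which is not imported here
(it sits above the `GL_n` Satake/Flath files). Hall 2015, Cor. 3.44–3.45.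
[cite: Hall2015, Cor. 3.44] -/
private theorem IsArchSmooth.continuous_comp_mul' [FiniteDimensional ℝ A]
    (hreg : ∀ X : Matrix N N A, (∀ t : ℝ, expGL (t • X) ∈ H.carrier) → X ∈ H.lie)
    {φ : G → ℂ} (hφ : IsArchSmooth ι φ) (g : G) :
    Continuous fun y : H.carrier => φ (g * ι y) := by
  -- Mathlib idiom (Mathlib/Algebra/Lie/OfAssociative.lean), needed to name `𝔤.toSubmodule`
  letI : LieRing (Matrix N N A) := LieRing.ofAssociativeRing
  refine H.continuous_of_continuousAt_comp_expMem hreg fun x₀ => ?_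
  have h := (hφ (g * ι x₀)).continuous.continuousAt
    (x := (0 : H.lie.toSubmodule))
  simpa only [map_mul, mul_assoc] using h

/-- A function on `H` that is smooth in the archimedean variable (for `ι = id`) is continuous
(linear real group with full Lie algebra, finite-dimensional coefficients).
Hall 2015, Cor. 3.44–3.45. [cite: Hall2015, Cor. 3.44] -/
theorem IsArchSmooth.continuous_of_id [FiniteDimensional ℝ A]
    (hreg : ∀ X : Matrix N N A, (∀ t : ℝ, expGL (t • X) ∈ H.carrier) → X ∈ H.lie)
    {ψ : H.carrier → ℂ} (hψ : IsArchSmooth (MonoidHom.id H.carrier) ψ) : Continuous ψ := by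
  simpa only [MonoidHom.id_apply, one_mul] using
    hψ.continuous_comp_mul' (MonoidHom.id H.carrier) hreg 1

/-- Off the topological support of `ψ` the Lie derivative `X ψ` vanishes: the curve
`t ↦ y exp (tX)` stays outside `supp ψ` for small `t`, so `t ↦ ψ (y exp tX)` is locally zero.
[folklore] -/
theorem lieDeriv_id_eq_zero_of_notMem_tsupport {ψ : H.carrier → ℂ} (X : H.lie) {y : H.carrier}
    (hy : y ∉ tsupport ψ) : lieDeriv (MonoidHom.id H.carrier) X ψ y = 0 := by
  have hcont : Continuous fun t : ℝ => y * H.expMem (t • X) :=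
    continuous_const.mul (continuous_expMem_smul X)
  have h0 : y * H.expMem ((0 : ℝ) • X) = y := by rw [expMem_zero_smul, mul_one]
  have hev : (fun t : ℝ => ψ (y * H.expMem (t • X))) =ᶠ[𝓝 0] fun _ => (0 : ℂ) := by
    have hopen : IsOpen (tsupport ψ)ᶜ := (isClosed_tsupport ψ).isOpen_compl
    have hy0 : (fun t : ℝ => y * H.expMem (t • X)) 0 ∈ (tsupport ψ)ᶜ := by
      change y * H.expMem ((0 : ℝ) • X) ∈ (tsupport ψ)ᶜ
      rwa [h0]
    filter_upwards [hcont.continuousAt.eventually_mem (hopen.mem_nhds hy0)] with t ht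
    exact image_eq_zero_of_notMem_tsupport ht
  unfold lieDeriv
  simp only [MonoidHom.id_apply]
  rw [hev.deriv_eq]
  exact deriv_const 0 0

/-- The Lie derivative of a compactly supported function on `H` is compactly supported (its support
lies in that of the function). [folklore] -/
theorem hasCompactSupport_lieDeriv_id {ψ : H.carrier → ℂ} (hψ : HasCompactSupport ψ) (X : H.lie) :
    HasCompactSupport (lieDeriv (MonoidHom.id H.carrier) X ψ) :=
  HasCompactSupport.intro' hψ.isCompact (isClosed_tsupport ψ)
    fun _ hy => lieDeriv_id_eq_zero_of_notMem_tsupport X hy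

/-! ### `X (φ ∗ α) = φ ∗ X α` -/

variable [MeasurableSpace H.carrier] [BorelSpace H.carrier]

/-- **The Lie derivative of a convolution is the convolution with the derived weight** (Borel 1997,
2.2–2.3 (1) and Cor. 5.3 (1): `(f ∗ α)(x) = ∫ f(xy) α(y⁻¹) dy`, `D(f ∗ α) = f ∗ Dα`;
Moeglin–Waldspurger 1995, Lemma I.2.5 (a)). Let `H` be a linear
real group with full Lie algebra over a finite-dimensional coefficient algebra, `ν` a left invariant
measure on `H` finite on compacta, `φ : G → ℂ` smooth in the archimedean variable, and
`α : H → ℂ` compactly supported and smooth, with `φ(h) = ∫ φ(h ι(y)) α(y⁻¹) dν(y)` for all `h`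
(`φ = φ ∗ α`). Then `(X φ)(g) = ∫ φ(g ι(y)) (Xα)(y⁻¹) dν(y)` for every `X ∈ 𝔤`: by left invariance
`φ(g ι(exp tX)) = ∫ φ(g ι(y)) α(y⁻¹ exp tX) dν(y)`, the integrand has `t`-derivative
`φ(g ι(y)) (Xα)(y⁻¹ exp tX)` (`IsArchSmooth.hasDerivAt_flow`), dominated on `|t| < 1` by a
continuous compactly supported function, and one differentiates under the integral sign.
[cite: Borel1997, 2.3 (1) and Cor. 5.3] -/
theorem lieDeriv_eq_integral_of_convolution_eq [FiniteDimensional ℝ A]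
    (hreg : ∀ X : Matrix N N A, (∀ t : ℝ, expGL (t • X) ∈ H.carrier) → X ∈ H.lie)
    (ν : Measure H.carrier) [ν.IsMulLeftInvariant] [IsFiniteMeasureOnCompacts ν]
    {φ : G → ℂ} (hφ : IsArchSmooth ι φ) {α : H.carrier → ℂ} (hαs : HasCompactSupport α)
    (hα : IsArchSmooth (MonoidHom.id H.carrier) α) (X : H.lie)
    (hconv : ∀ h : G, φ h = ∫ y, φ (h * ι y) * α y⁻¹ ∂ν) (g : G) :
    lieDeriv ι X φ g = ∫ y, φ (g * ι y) * lieDeriv (MonoidHom.id H.carrier) X α y⁻¹ ∂ν := by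
  set αX : H.carrier → ℂ := lieDeriv (MonoidHom.id H.carrier) X α with hαX_def
  have hαc : Continuous α := hα.continuous_of_id hreg
  have hαXs : HasCompactSupport αX := hasCompactSupport_lieDeriv_id hαs X
  have hαXc : Continuous αX :=
    (isArchSmooth_lieDeriv_holds (ι := MonoidHom.id H.carrier) X hα).continuous_of_id hreg
  have hφg : Continuous fun y : H.carrier => φ (g * ι y) := hφ.continuous_comp_mul' ι hreg g
  have hexpc : Continuous fun t : ℝ => H.expMem (t • X) := continuous_expMem_smul X
  -- the parametrised integrand and its derivative
  set F : ℝ → H.carrier → ℂ := fun t y => φ (g * ι y) * α (y⁻¹ * H.expMem (t • X)) with hF_def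
  set F' : ℝ → H.carrier → ℂ := fun t y => φ (g * ι y) * αX (y⁻¹ * H.expMem (t • X))
    with hF'_def
  -- `φ(g ι(exp tX)) = ∫ F t`, by the convolution identity and left invariance of `ν`
  have hFt : ∀ t : ℝ, φ (g * ι (H.expMem (t • X))) = ∫ y, F t y ∂ν := by
    intro t
    rw [hconv (g * ι (H.expMem (t • X))), hF_def]
    dsimp only
    conv_rhs => rw [← integral_mul_left_eq_self _ (H.expMem (t • X))]
    congr 1 with y
    rw [map_mul, ← mul_assoc, mul_inv_rev, inv_mul_cancel_right]
  -- continuity of `F t`, `F' t` in `y`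
  have hFc : ∀ t, Continuous (F t) := fun t =>
    hφg.mul (hαc.comp (continuous_inv.mul continuous_const))
  have hF'c : ∀ t, Continuous (F' t) := fun t =>
    hφg.mul (hαXc.comp (continuous_inv.mul continuous_const))
  -- a compact set carrying the supports of all `F' t`, `|t| ≤ 1`
  set S : Set H.carrier :=
    (fun p : ℝ × H.carrier => H.expMem (p.1 • X) * p.2⁻¹) '' (Set.Icc (-1) 1 ×ˢ tsupport αX)
    with hS_def
  have hS : IsCompact S :=
    (isCompact_Icc.prod hαXs.isCompact).image ((hexpc.comp continuous_fst).mul continuous_snd.inv)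
  obtain ⟨M, hM⟩ := hαXs.exists_bound_of_continuous hαXc
  set bound : H.carrier → ℝ := S.indicator fun y => ‖φ (g * ι y)‖ * M with hbound_def
  have hsupp : ∀ t ∈ Metric.ball (0 : ℝ) 1, ∀ y, ‖F' t y‖ ≤ bound y := by
    intro t ht y
    rw [hF'_def, hbound_def]
    dsimp only
    by_cases hy : y ∈ S
    · rw [Set.indicator_of_mem hy, norm_mul]
      exact mul_le_mul_of_nonneg_left (hM _) (norm_nonneg _)
    · -- off `S` the derived weight vanishes
      have hzero : αX (y⁻¹ * H.expMem (t • X)) = 0 := by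
        by_contra hne
        apply hy
        refine ⟨(t, y⁻¹ * H.expMem (t • X)), ⟨?_, subset_tsupport _ hne⟩, ?_⟩
        · rw [Metric.mem_ball, dist_zero_right, Real.norm_eq_abs, abs_lt] at ht
          exact ⟨ht.1.le, ht.2.le⟩
        · dsimp only
          rw [mul_inv_rev, inv_inv, mul_inv_cancel_left]
      rw [hzero, mul_zero, norm_zero, Set.indicator_of_notMem hy]
  have hbound_int : Integrable bound ν := by
    rw [hbound_def]
    exact ((hφg.norm.mul continuous_const).continuousOn.integrableOn_compact
      hS).integrable_indicator hS.measurableSet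
  have hF0_int : Integrable (F 0) ν := by
    refine (hFc 0).integrable_of_hasCompactSupport ?_
    refine HasCompactSupport.mul_left ?_
    have h1 : (fun y : H.carrier => α (y⁻¹ * H.expMem ((0 : ℝ) • X))) =
        α ∘ (Homeomorph.inv H.carrier) := by
      funext y
      rw [expMem_zero_smul, mul_one]
      rfl
    rw [h1]
    exact hαs.comp_homeomorph _
  have hdiff : ∀ y, ∀ t ∈ Metric.ball (0 : ℝ) 1, HasDerivAt (F · y) (F' t y) t := by
    intro y t _
    have h := hα.hasDerivAt_flow (MonoidHom.id H.carrier) X y⁻¹ t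
    simp only [MonoidHom.id_apply] at h
    exact h.const_mul (φ (g * ι y))
  -- differentiate under the integral sign at `t = 0`
  have hmain := hasDerivAt_integral_of_dominated_loc_of_deriv_le (μ := ν) (F := F) (F' := F')
    (x₀ := (0 : ℝ)) (bound := bound) (Metric.ball_mem_nhds (0 : ℝ) one_pos)
    (Eventually.of_forall fun t => (hFc t).aestronglyMeasurable) hF0_int
    ((hF'c 0).aestronglyMeasurable) (Eventually.of_forall fun y t ht => hsupp t ht y) hbound_int
    (Eventually.of_forall hdiff)
  -- identify the derivative at `0` with the Lie derivative
  have hdef : lieDeriv ι X φ g = deriv (fun t : ℝ => φ (g * ι (H.expMem (t • X)))) 0 := rfl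
  have hcurve : (fun t : ℝ => φ (g * ι (H.expMem (t • X)))) = fun t => ∫ y, F t y ∂ν :=
    funext hFt
  rw [hdef, hcurve, hmain.2.deriv, hF'_def]
  simp only [expMem_zero_smul, mul_one]

end General

/-! ### The regular automorphy datum: moderate growth of `X φ`, and Borel–Jacquet 4.3 -/

section Datum

variable {K : Type} [Field K] [NumberField K]
  {A : Type*} [NormedCommRing A] [NormedAlgebra ℝ A] [NormedAlgebra ℚ A] [CompleteSpace A]
  [StarRing A] {N : Type*} [Fintype N] [DecidableEq N]
  {𝒢 : AdelicGroupData K} {𝒟 : AutomorphyDatum 𝒢 A N}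

/-- **Moderate growth of Lie derivatives from the convolution identity, general regular datum**
(Borel 1997, Prop. 5.2, Cor. 5.3 and 5.6 (c); Moeglin–Waldspurger 1995, Lemma I.2.5 (a): "`δ(f)φ`
and its derivatives have uniformly moderate growth"; Borel–Jacquet 1979, 4.3). For a regular datum
`𝒟` over a finite-dimensional coefficient algebra, a left invariant measure `ν` on `G_∞` finite on
compacta, a function `φ` on `G(𝔸_K)` smooth in the archimedean variable with
`‖φ(g)‖ ≤ C (1 ⊔ ‖g‖)^r`, and `α ∈ C_c^∞(G_∞)` with `φ(h) = ∫ φ(h x) α(x⁻¹) dν(x)` for all `h`,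
every Lie derivative satisfies `‖X φ(g)‖ ≤ C' (1 ⊔ ‖g‖)^r` (same `r`):
`X φ(g) = ∫ φ(g x) (Xα)(x⁻¹) dν`
(`lieDeriv_eq_integral_of_convolution_eq`), the integrand lives on the compact set
`T = (supp Xα)⁻¹`, where `1 ⊔ ‖g x‖ ≤ D (1 ⊔ ‖g‖)` (`IsRegular.height_mul_ofArch_le`).
[cite: Borel1997, Prop. 5.2 and Cor. 5.3] -/
theorem hasModerateGrowth_lieDeriv_of_convolution_eq [FiniteDimensional ℝ A]
    [MeasurableSpace 𝒟.arch.carrier] [BorelSpace 𝒟.arch.carrier] (h𝒟 : 𝒟.IsRegular)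
    (ν : Measure 𝒟.arch.carrier) [ν.IsMulLeftInvariant] [IsFiniteMeasureOnCompacts ν]
    {φ : 𝒢.Adelic → ℂ} (hφs : IsArchSmooth 𝒟.ofArch φ) (hφm : HasModerateGrowth 𝒟 φ)
    {α : 𝒟.arch.carrier → ℂ} (hαs : HasCompactSupport α)
    (hα : IsArchSmooth (MonoidHom.id 𝒟.arch.carrier) α)
    (hconv : ∀ h : 𝒢.Adelic, φ h = ∫ y, φ (h * 𝒟.ofArch y) * α y⁻¹ ∂ν) (X : 𝒟.arch.lie) :
    HasModerateGrowth 𝒟 (lieDeriv 𝒟.ofArch X φ) := by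
  have hreg := h𝒟.mem_lie_of_expGL_mem
  set αX : 𝒟.arch.carrier → ℂ := lieDeriv (MonoidHom.id 𝒟.arch.carrier) X α with hαX_def
  have hαXs : HasCompactSupport αX := hasCompactSupport_lieDeriv_id hαs X
  have hαXc : Continuous αX :=
    (isArchSmooth_lieDeriv_holds (ι := MonoidHom.id 𝒟.arch.carrier) X hα).continuous_of_id hreg
  have hint : ∀ g, lieDeriv 𝒟.ofArch X φ g = ∫ y, φ (g * 𝒟.ofArch y) * αX y⁻¹ ∂ν := fun g =>
    lieDeriv_eq_integral_of_convolution_eq 𝒟.ofArch hreg ν hφs hαs hα X hconv g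
  obtain ⟨C, r, hCr⟩ := hφm
  -- the compact set carrying the integrand, and the height bound on it
  set T : Set 𝒟.arch.carrier := (tsupport αX)⁻¹ with hT_def
  have hT : IsCompact T := hαXs.isCompact.inv
  obtain ⟨C₁, hC₁⟩ := h𝒟.height_mul_ofArch_le T hT
  set D : ℝ := C₁ ⊔ 1 with hD_def
  have hD0 : 0 ≤ D := zero_le_one.trans le_sup_right
  have hD : ∀ x ∈ T, ∀ g, 1 ⊔ 𝒟.height (g * 𝒟.ofArch x) ≤ D * (1 ⊔ 𝒟.height g) :=
    fun x hx g => (hC₁ x hx g).trans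
      (mul_le_mul_of_nonneg_right le_sup_left (zero_le_one.trans le_sup_left))
  obtain ⟨M, hM⟩ := hαXs.exists_bound_of_continuous hαXc
  have hM0 : 0 ≤ M := (norm_nonneg _).trans (hM 1)
  have hC0 : 0 ≤ C := by
    have h := hCr 1
    have hpos : (0 : ℝ) < (1 ⊔ 𝒟.height 1) ^ r := pow_pos (lt_of_lt_of_le one_pos le_sup_left) r
    exact nonneg_of_mul_nonneg_left ((norm_nonneg _).trans h) hpos
  refine ⟨C * D ^ r * M * ν.real T, r, fun g => ?_⟩
  have hg1 : (0 : ℝ) < 1 ⊔ 𝒟.height g := lt_of_lt_of_le one_pos le_sup_left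
  set c : ℝ := C * (D * (1 ⊔ 𝒟.height g)) ^ r * M with hc_def
  -- pointwise bound of the integrand
  have hptw : ∀ y, ‖φ (g * 𝒟.ofArch y) * αX y⁻¹‖ ≤ T.indicator (fun _ => c) y := by
    intro y
    by_cases hy : y ∈ T
    · rw [Set.indicator_of_mem hy, norm_mul, hc_def]
      refine mul_le_mul ?_ (hM _) (norm_nonneg _) (by positivity)
      refine (hCr _).trans (mul_le_mul_of_nonneg_left ?_ hC0)
      exact pow_le_pow_left₀ (zero_le_one.trans le_sup_left) (hD y hy g) r
    · have hy' : y⁻¹ ∉ tsupport αX := fun h => hy (by rwa [hT_def, Set.mem_inv])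
      rw [image_eq_zero_of_notMem_tsupport hy', mul_zero, norm_zero, Set.indicator_of_notMem hy]
  -- integrate
  rw [hint g]
  refine (norm_integral_le_integral_norm _).trans ?_
  have hconst : Integrable (T.indicator fun _ : 𝒟.arch.carrier => c) ν :=
    (integrableOn_const (C := c) (hs := hT.measure_lt_top.ne)).integrable_indicator hT.measurableSet
  refine (integral_mono_of_nonneg (Eventually.of_forall fun y => norm_nonneg _) hconst
    (Eventually.of_forall hptw)).trans ?_
  rw [integral_indicator_const _ hT.measurableSet, smul_eq_mul, hc_def, mul_pow]
  have : ν.real T * (C * (D ^ r * (1 ⊔ 𝒟.height g) ^ r) * M) =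
      C * D ^ r * M * ν.real T * (1 ⊔ 𝒟.height g) ^ r := by ring
  rw [this]

/-- **Borel–Jacquet 1979, 4.3 for a general regular datum, from Harish-Chandra's convolution
identity alone.** If for every left Haar measure `ν` on `G_∞ = 𝒟.arch` and every automorphic form
`φ` of the regular datum `𝒟` (finite-dimensional coefficients) there is `α ∈ C_c^∞(G_∞)` with
`φ = φ ∗ α`, i.e. `φ(h) = ∫ φ(h x) α(x⁻¹) dν(x)` for all `h ∈ G(𝔸_K)` — the conclusion of
Harish-Chandra's theorem (Harish-Chandra 1966, §8 Thm. 1; Borel 1972, Thm. 3.18 and Cor. 3.19;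
Moeglin–Waldspurger 1995, I.2.17, Lemma; Borel 1997, Thm. 2.14 and 5.6 (b)) — then the space of
automorphic forms of `𝒟` is `(𝔤, K_∞) × G(𝔸_f)`-stable, i.e. the named fact
`automorphicForms_isStableSubmodule 𝒟` holds: `automorphicForms_isStableSubmodule_of` with the
discharged calculus facts `isArchSmooth_lieDeriv_holds`, `applyFree_congr_holds` and
`hasModerateGrowth_lieDeriv_of_convolution_eq` for the Haar measure `Measure.haar` on the closed
subgroup `G_∞ ≤ GL(N, A)` (locally compact as `A` is finite-dimensional).
[cite: BorelJacquetCorvallis1979, 4.3] -/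
theorem automorphicForms_isStableSubmodule_of_convolution_identity
    (hHC : ∀ [FiniteDimensional ℝ A] [MeasurableSpace 𝒟.arch.carrier] [BorelSpace 𝒟.arch.carrier]
      (ν : Measure 𝒟.arch.carrier) [ν.IsHaarMeasure], 𝒟.IsRegular →
      ∀ φ : 𝒢.Adelic → ℂ, IsAutomorphicForm 𝒟 φ →
        ∃ α : 𝒟.arch.carrier → ℂ, HasCompactSupport α ∧
          IsArchSmooth (MonoidHom.id 𝒟.arch.carrier) α ∧
            ∀ h : 𝒢.Adelic, φ h = ∫ y, φ (h * 𝒟.ofArch y) * α y⁻¹ ∂ν) :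
    automorphicForms_isStableSubmodule 𝒟 := by
  refine automorphicForms_isStableSubmodule_of isArchSmooth_lieDeriv_holds applyFree_congr_holds ?_
  intro _ h𝒟 φ hφ X
  -- a left Haar measure on the locally compact group `G_∞`
  letI : MeasurableSpace 𝒟.arch.carrier := borel _
  haveI : BorelSpace 𝒟.arch.carrier := ⟨rfl⟩
  haveI : LocallyCompactSpace (Matrix N N A) := inferInstanceAs (LocallyCompactSpace (N → N → A))
  haveI : LocallyCompactSpace (GL N A) := inferInstance
  haveI : LocallyCompactSpace 𝒟.arch.carrier := 𝒟.arch.isClosed.locallyCompactSpace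
  obtain ⟨α, hαs, hα, hconv⟩ := hHC Measure.haar h𝒟 φ hφ
  exact hasModerateGrowth_lieDeriv_of_convolution_eq h𝒟 Measure.haar hφ.archSmooth hφ.moderateGrowth
    hαs hα hconv X

end Datum

end Literature.NumberTheory.Automorphic
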